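import Literature.Computability.MetaComplexity.FregeBounded

/-!
# PneNP / ExpanderLinearGenerators — depth-bounded derivability in `textbookFrege` without size
bookkeeping (toolkit for the depth-`7` refutation-completeness theorem)

Route `PneNP/ExpanderLinearGenerators`, support for cruxes stmt-PneNP-11442 / 11443 / 11444, whose
conclusions quantify over depth-`d` `textbookFrege` proofs `π` of `¬ ofCNF (sumEncoding 1 E)`.
The sibling files pin the depth parameter from both sides: no such `π` exists for `d ≤ 6`
(`seven_le_of_isDepthProofOf_neg_ofCNF`, file `…ConjAxiomDepthFloor`), and one exists for
`d ≥ 30` (`exists_isDepthProofOf_neg_ofCNF`, file `…LinearGeneratorModPFregeHardCalibration`).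
The companion file `…DepthSevenCompleteness` closes the gap `7 ≤ d ≤ 29`: depth `7` suffices,
so the depth threshold of the three rungs is EXACT. This file is its toolkit.

The working predicate is the size-free shadow `∃ B ℓ, TextbookFrege.BD D B ℓ φ` of the
bounded-derivation predicate of `Literature/Computability/MetaComplexity/FregeBounded.lean`:
`φ` has a `textbookFrege`-derivation from no hypotheses all of whose lines have disjunct depth
`dd ≤ D` (hence alternation depth `≤ D + 1`), of some size and length. Every rule below (namespace
`DD`) is the corresponding bounded rule of that file with its size side condition discharged by
enlarging the (irrelevant) size bound. The DEPTH side conditions are kept verbatim — they are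
exact, and the depth-`7` construction lives on their slack. No new definition is introduced.

Contents: `DD.exists_isDepthProofOf`; the rule schemes `DD.ax`, `DD.expan`, `DD.contr`,
`DD.assoc`, `DD.cut`, `DD.conjAx₁`, `DD.negBot`; Hodel's derived rules `DD.comm`, `DD.expan'`,
`DD.assoc'`, `DD.negNeg`, `DD.genExp`, `DD.genCtn`, `DD.removeBot`; `DD.cutContr`.

References: J. R. Shoenfield, *Mathematical Logic* (1967), §2.6, §3.1; R. E. Hodel, *An
Introduction to Mathematical Logic* (1995), Ch. 3; J. Krajíček, *Bounded arithmetic, propositional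
logic, and complexity theory* (CUP 1995), §4.3 (depth). The statements are folklore.
-/

namespace Summit.PneNP.PneNP.Theorems

set_option linter.dupNamespace false -- `Summit.PneNP.PneNP.…`: summit = sub-problem (D-0017)

open Literature.Computability.Complexity Literature.Computability.Complexity.PropForm
open Literature.Computability.MetaComplexity Literature.Computability.MetaComplexity.TextbookFrege

namespace DD

variable {D : ℕ} {a b c φ : PropForm ℕ}

/-- **From depth-bounded derivations to bounded-depth proofs**: a derivation all of whose lines
have disjunct depth `≤ D` is a depth-`(D+1)` `textbookFrege`-proof. [Krajíček 1995, §4.3]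
[folklore] -/
theorem exists_isDepthProofOf (h : ∃ B ℓ, BD D B ℓ φ) :
    ∃ π, textbookFrege.IsDepthProofOf (D + 1) π φ := by
  obtain ⟨B, ℓ, h⟩ := h
  obtain ⟨π, hπ, -⟩ := h.exists_isDepthProofOf
  exact ⟨π, hπ⟩

/-- The conclusion has disjunct depth `≤ D`. [folklore] -/
theorem dd_le (h : ∃ B ℓ, BD D B ℓ φ) : φ.dd ≤ D := by
  obtain ⟨B, ℓ, h⟩ := h
  exact h.lineOK.1

/-! ### The rule schemes -/

/-- Propositional axiom `¬A ∨ A`. [Shoenfield 1967, §2.6] [folklore] -/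
theorem ax (a : PropForm ℕ) (ha : (disj (neg a) a).dd ≤ D) : ∃ B ℓ, BD D B ℓ (disj (neg a) a) :=
  ⟨_, _, axB a ⟨ha, le_rfl⟩⟩

/-- Expansion `A ⊢ B ∨ A`. [Shoenfield 1967, §2.6] [folklore] -/
theorem expan (b : PropForm ℕ) (h : ∃ B ℓ, BD D B ℓ a) (hb : (disj b a).dd ≤ D) :
    ∃ B ℓ, BD D B ℓ (disj b a) := by
  obtain ⟨B, ℓ, h⟩ := h
  exact ⟨_, _, expanB b (h.weaken le_rfl (le_max_left B (disj b a).size)) ⟨hb, le_max_right _ _⟩⟩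

/-- Contraction `A ∨ A ⊢ A`. [Shoenfield 1967, §2.6] [folklore] -/
theorem contr (h : ∃ B ℓ, BD D B ℓ (disj a a)) : ∃ B ℓ, BD D B ℓ a := by
  obtain ⟨B, ℓ, h⟩ := h
  exact ⟨_, _, contrB h⟩

/-- Associativity `A ∨ (B ∨ C) ⊢ (A ∨ B) ∨ C`. [Shoenfield 1967, §2.6] [folklore] -/
theorem assoc (h : ∃ B ℓ, BD D B ℓ (disj a (disj b c))) : ∃ B ℓ, BD D B ℓ (disj (disj a b) c) := by
  obtain ⟨B, ℓ, h⟩ := h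
  exact ⟨_, _, assocB h⟩

/-- Cut `A ∨ B, ¬A ∨ C ⊢ B ∨ C`. [Shoenfield 1967, §2.6] [folklore] -/
theorem cut (h₁ : ∃ B ℓ, BD D B ℓ (disj a b)) (h₂ : ∃ B ℓ, BD D B ℓ (disj (neg a) c)) :
    ∃ B ℓ, BD D B ℓ (disj b c) := by
  obtain ⟨B₁, ℓ₁, h₁⟩ := h₁
  obtain ⟨B₂, ℓ₂, h₂⟩ := h₂
  set B := max (max B₁ B₂) (b.size + c.size + 1) with hB
  refine ⟨B, _, cutB (h₁.weaken le_rfl ?_) (h₂.weaken le_rfl ?_) ?_⟩ <;> omega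

/-- First definitional axiom for `∧`: `⊢ ¬(A ∧ B) ∨ ¬(¬A ∨ ¬B)`. [Hodel 1995, p. 100] [folklore] -/
theorem conjAx₁ (a b : PropForm ℕ)
    (hl : (disj (neg (conj a b)) (neg (disj (neg a) (neg b)))).dd ≤ D) :
    ∃ B ℓ, BD D B ℓ (disj (neg (conj a b)) (neg (disj (neg a) (neg b)))) :=
  ⟨_, _, conjAx₁B a b ⟨hl, le_rfl⟩⟩

/-- Axiom `⊢ ¬⊥`. [Buss 1998, §1.1] [folklore] -/
theorem negBot (hD : 1 ≤ D) : ∃ B ℓ, BD D B ℓ (neg (const false)) :=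
  ⟨2, 1, negBotB hD le_rfl⟩

/-! ### Hodel's derived rules -/

/-- Commutation `A ∨ B ⊢ B ∨ A` (the axiom `¬A ∨ A` is used: `(¬A).dd ≤ D`).
[Hodel 1995, p. 101 (CM)] [folklore] -/
theorem comm (h : ∃ B ℓ, BD D B ℓ (disj a b)) (ha : (neg a).dd ≤ D) :
    ∃ B ℓ, BD D B ℓ (disj b a) := by
  obtain ⟨B, ℓ, h⟩ := h
  exact ⟨_, _, commB (h.weaken le_rfl (le_max_left B (2 * a.size + 2))) ha (le_max_right _ _)⟩

/-- New expansion `A ⊢ A ∨ B`. [Hodel 1995, p. 102] [folklore] -/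
theorem expan' (b : PropForm ℕ) (h : ∃ B ℓ, BD D B ℓ a) (hb : (neg b).dd ≤ D) :
    ∃ B ℓ, BD D B ℓ (disj a b) := by
  obtain ⟨B, ℓ, h⟩ := h
  set B' := max B (2 * (a.size + b.size) + 2) with hB'
  refine ⟨B', _, expan'B b (h.weaken le_rfl ?_) hb ?_ ?_⟩ <;> omega

/-- New associativity `(A ∨ B) ∨ C ⊢ A ∨ (B ∨ C)`. [Hodel 1995, p. 102] [folklore] -/
theorem assoc' (h : ∃ B ℓ, BD D B ℓ (disj (disj a b) c)) (ha : a.dd + 2 ≤ D) (hb : b.dd + 2 ≤ D)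
    (hc : c.dd + 2 ≤ D) : ∃ B ℓ, BD D B ℓ (disj a (disj b c)) := by
  obtain ⟨B, ℓ, h⟩ := h
  set B' := max B (2 * (a.size + b.size + c.size) + 4) with hB'
  refine ⟨B', _, assoc'B (h.weaken le_rfl ?_) ha hb hc ?_⟩ <;> omega

/-- `¬¬`-introduction on the first disjunct `A ∨ B ⊢ ¬¬A ∨ B`. [Hodel 1995, p. 102] [folklore] -/
theorem negNeg (h : ∃ B ℓ, BD D B ℓ (disj a b)) (ha : (neg a).dd ≤ D) (hb : (neg b).dd ≤ D) :
    ∃ B ℓ, BD D B ℓ (disj (neg (neg a)) b) := by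
  obtain ⟨B, ℓ, h⟩ := h
  set B' := max B (2 * (a.size + b.size) + 6) with hB'
  refine ⟨B', _, negNegB (h.weaken le_rfl ?_) ha hb ?_⟩ <;> omega

/-- Generalized expansion `A ∨ B ⊢ A ∨ (C ∨ B)`. [Hodel 1995, p. 112 (GEN EXP)] [folklore] -/
theorem genExp (c : PropForm ℕ) (h : ∃ B ℓ, BD D B ℓ (disj a b)) (ha : (neg a).dd ≤ D)
    (hb : b.dd + 2 ≤ D) (hc : c.dd + 2 ≤ D) : ∃ B ℓ, BD D B ℓ (disj a (disj c b)) := by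
  obtain ⟨B, ℓ, h⟩ := h
  set B' := max B (2 * (a.size + b.size + c.size) + 4) with hB'
  refine ⟨B', _, genExpB c (h.weaken le_rfl ?_) ha hb hc ?_⟩ <;> omega

/-- Generalized contraction `A ∨ (B ∨ B) ⊢ A ∨ B`. [Hodel 1995, p. 112 (GEN CTN)] [folklore] -/
theorem genCtn (h : ∃ B ℓ, BD D B ℓ (disj a (disj b b))) (ha : a.dd + 2 ≤ D) (hb : b.dd + 2 ≤ D) :
    ∃ B ℓ, BD D B ℓ (disj a b) := by
  obtain ⟨B, ℓ, h⟩ := h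
  set B' := max B (2 * (a.size + 2 * b.size) + 6) with hB'
  refine ⟨B', _, genCtnB (h.weaken le_rfl ?_) ha hb ?_⟩ <;> omega

/-- Removal of a trailing `⊥`: `A ∨ ⊥ ⊢ A`. [folklore] -/
theorem removeBot (h : ∃ B ℓ, BD D B ℓ (disj a (const false))) (ha : (neg a).dd ≤ D) :
    ∃ B ℓ, BD D B ℓ a := by
  obtain ⟨B, ℓ, h⟩ := h
  set B' := max B (4 * a.size + 8) with hB'
  refine ⟨B', _, removeBotB (h.weaken le_rfl ?_) ha ?_⟩ <;> omega

/-- Cut on the first disjunct followed by contraction: `A ∨ B, ¬A ∨ B ⊢ B`. [Shoenfield 1967,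
§2.6] [folklore] -/
theorem cutContr (h₁ : ∃ B ℓ, BD D B ℓ (disj a b)) (h₂ : ∃ B ℓ, BD D B ℓ (disj (neg a) b)) :
    ∃ B ℓ, BD D B ℓ b :=
  contr (cut h₁ h₂)

end DD

end Summit.PneNP.PneNP.Theorems
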